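import Summits.ABC.StewartYu.ArchG3RecA
import Summits.ABC.StewartYu.RecordExitsNumeric
import HarnessLib

/-!
# The archimedean record of reference `ArchG3Rec` — the END scalar lines (K1), (K2) on the capped letters

Support file (elementary theorems; no named facts). Cell `abc-stewartyu`, route `YuMatveevShapeRat`, crux r2 `ArchCoreRat`
(stmt-ABC-20502, plan R32/R36); seat p1 (record owner). The END letters of `ArchG3Rec` are `D₀ = L₀ + 1`,
`S₀ = M/(n+2)⁴`, `X_fin = ⌊2ⁿ·Xs Ŝ/(n+1)⌋`, `D j = ⌊KNL/(2^Ŝ A j)⌋ + 1`. This file proves the two scalar lines that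
refute exit A of the zero estimate through `RecordExitsNumeric.exitA_of_bounds` (clause (A) of p4's `RecordArchW`):
* **(K1)** `2n(n+1)·(L/2^{n+23} + 1) ≤ S₀ + 1` with `D j ≤ L/2^{n+23} + 1` (N-free END degrees);
* **(K2)** `(n+1)²·D₀ < (S₀ + 1)·(2X_fin + 1)` — from `2^{n+22}X ≤ Xs Ŝ` (print (5.12), capped schedule) and
  `C_bⁿΩK/N ≤ L/24` (the balanced scale: `WN ≤ W·N`), so `D₀ ≤ XL/4 + 2`;
and the exit-A clause itself (`exitA`). NO `hcorner` hypothesis is used here (R36(b)).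

## References
* [Nesterenko2003] Yu. V. Nesterenko, LNM 1819 (2003) — §5.2 Lemma 5.2–5.3, (5.6), (5.8), (5.11)–(5.16) (pp. 97–101).
-/

noncomputable section

open Finset Real

namespace Summit.ABC.StewartYu

namespace ArchG3Rec

open PadicG3Par (cG cM Cb cG_pos Cb_pos)
open ArchG3Par (G K SdK yloadK G_eq eight_le_G G_pos one_le_K K_pos two_G_le_yloadK yloadK_pos)
open RecordExitsNumeric (mul_pow_four_le_two_pow succ_mul_pow_four_le_two_pow)

variable {n : ℕ} (P : ArchG3Rec n)

/-! ### `S₀` -/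

/-- `16(n+1)L < (S₀ + 1)(n+2)⁴` (so `S₀ + 1 > M/(n+2)⁴`). [cite: Nesterenko2003, §5.2 (5.8)] -/
theorem M_lt_S₀_succ_mul : 16 * (n + 1) * P.L < (P.S₀ + 1) * (n + 2) ^ 4 := by
  unfold S₀ M
  have h := Nat.lt_div_mul_add (a := 16 * (n + 1) * P.L) (b := (n + 2) ^ 4) (by positivity)
  calc 16 * (n + 1) * P.L < 16 * (n + 1) * P.L / (n + 2) ^ 4 * (n + 2) ^ 4 + (n + 2) ^ 4 := h
    _ = (16 * (n + 1) * P.L / (n + 2) ^ 4 + 1) * (n + 2) ^ 4 := by ring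

/-! ### The END degrees are `N`-free -/

/-- **`D j ≤ L/2^{n+23} + 1`** (`KNL/(2^Ŝ A j) < L/2^{n+23}` as `2^Ŝ > 2^{n+23}KN` and `A j ≥ 1`).
[cite: Nesterenko2003, §5.2 (5.5)–(5.6)] -/
theorem D_le (j : Fin n) : P.D j ≤ P.L / 2 ^ (n + 23) + 1 := by
  unfold D
  refine Nat.add_le_add_right ?_ 1
  obtain ⟨hA0, hA1, -⟩ := P.A_facts j
  have hKN : (0 : ℝ) < (K n : ℝ) * P.N := by
    have := K_pos n; have := P.N_facts.1; positivity
  have hS : (2 : ℝ) ^ (n + 23) * ((K n : ℝ) * P.N) < (2 : ℝ) ^ P.Sd := by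
    exact_mod_cast P.Sd_sandwich.1
  have hL : (0 : ℝ) ≤ P.L := Nat.cast_nonneg _
  have h1 : (K n : ℝ) * P.N * P.L / (2 ^ P.Sd * P.A j) ≤ (P.L : ℝ) / 2 ^ (n + 23) := by
    rw [div_le_div_iff₀ (by positivity) (by positivity)]
    calc (K n : ℝ) * P.N * P.L * 2 ^ (n + 23) = (2 ^ (n + 23) * ((K n : ℝ) * P.N)) * P.L * 1 := by ring
      _ ≤ (2 : ℝ) ^ P.Sd * P.L * P.A j := by
          refine mul_le_mul (mul_le_mul_of_nonneg_right hS.le hL) hA1 zero_le_one (by positivity)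
      _ = P.L * (2 ^ P.Sd * P.A j) := by ring
  calc ⌊(K n : ℝ) * P.N * P.L / (2 ^ P.Sd * P.A j)⌋₊ ≤ ⌊(P.L : ℝ) / 2 ^ (n + 23)⌋₊ := Nat.floor_le_floor h1
    _ = P.L / 2 ^ (n + 23) := by
        rw [show ((2 : ℝ) ^ (n + 23)) = ((2 ^ (n + 23) : ℕ) : ℝ) by push_cast; ring]
        exact Nat.floor_div_eq_div _ _

/-! ### (K1) -/

/-- **(K1)** `2n(n+1)·(L/2^{n+23} + 1) ≤ S₀ + 1`. [cite: Nesterenko2003, §5.2 (5.13)–(5.14)] -/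
theorem K1 : 2 * n * (n + 1) * (P.L / 2 ^ (n + 23) + 1) ≤ P.S₀ + 1 := by
  have h25 := P.L_floors.1
  have hq4 : 4 ≤ P.L / 2 ^ (n + 23) := by
    rw [Nat.le_div_iff_mul_le (by positivity)]
    calc 4 * 2 ^ (n + 23) = 2 ^ (n + 25) := by ring
      _ ≤ P.L := h25
  have hqL : P.L / 2 ^ (n + 23) * 2 ^ (n + 23) ≤ P.L := Nat.div_mul_le_self _ _
  have hpoly := mul_pow_four_le_two_pow n
  have hmain : 2 * n * (n + 1) * (P.L / 2 ^ (n + 23) + 1) * (n + 2) ^ 4 ≤ P.M := by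
    unfold M
    generalize P.L / 2 ^ (n + 23) = q at hq4 hqL ⊢
    calc 2 * n * (n + 1) * (q + 1) * (n + 2) ^ 4
        ≤ 2 * n * (n + 1) * (2 * q) * (n + 2) ^ 4 := by gcongr; omega
      _ = 4 * (n + 1) * q * (n * (n + 2) ^ 4) := by ring
      _ ≤ 4 * (n + 1) * q * 2 ^ (n + 24) := Nat.mul_le_mul_left _ hpoly
      _ = 8 * (n + 1) * (q * 2 ^ (n + 23)) := by ring
      _ ≤ 8 * (n + 1) * P.L := Nat.mul_le_mul_left _ hqL
      _ ≤ 16 * (n + 1) * P.L := by gcongr; norm_num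
  have h4 : 0 < (n + 2) ^ 4 := Nat.pow_pos (by omega)
  have h : 2 * n * (n + 1) * (P.L / 2 ^ (n + 23) + 1) ≤ P.S₀ := by
    show _ ≤ P.M / (n + 2) ^ 4
    exact (Nat.le_div_iff_mul_le h4).mpr hmain
  exact h.trans (Nat.le_succ _)

/-! ### (K2) -/

/-- `WN ≤ W·N` (`log N ≤ N − 1 ≤ W·(N − 1)`): the unit ratio `W/WN` is at least `1/N`. [folklore] -/
theorem WN_le_W_mul_N : P.WN ≤ P.W * P.N := by
  obtain ⟨hN0, hN1, -⟩ := P.N_facts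
  have hlog : Real.log (P.N : ℝ) ≤ (P.N : ℝ) - 1 := Real.log_le_sub_one_of_pos hN0
  have hW := P.hW
  unfold WN
  nlinarith

/-- **`C_bⁿ Ω K/N ≤ L/24`** — the balanced scale still dominates the Siegel core divided by the index
(`24C_bⁿΩK·(W/WN) ≤ L` and `W/WN ≥ 1/N`). [cite: Nesterenko2003, §3.5 (3.23)] -/
theorem core_div_N_le : Cb ^ n * P.Ω * K n / P.N ≤ (P.L : ℝ) / 24 := by
  have h := P.core_le_L.2
  obtain ⟨hN0, -, -⟩ := P.N_facts
  have hWN0 := P.WN_bounds.2.2.2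
  have hW := P.hW
  have hc : 0 ≤ Cb ^ n * P.Ω * K n := by
    have := P.Ω_facts.1; have := K_pos n; have := Cb_pos; positivity
  have h1 : 1 / (P.N : ℝ) ≤ P.W / P.WN := by
    rw [div_le_div_iff₀ hN0 hWN0, one_mul]; exact P.WN_le_W_mul_N
  have h2 : Cb ^ n * P.Ω * K n / P.N ≤ Cb ^ n * P.Ω * K n * (P.W / P.WN) := by
    rw [div_eq_mul_one_div]; exact mul_le_mul_of_nonneg_left h1 hc
  linarith

/-- **`1 ≤ D₀ ≤ X·L/4 + 2`** (`D₀ = ⌈6XC_bⁿΩK/N⌉ + 1` and `C_bⁿΩK/N ≤ L/24`). [cite: Nesterenko2003, §5.2 (5.16)] -/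
theorem D₀_bounds : (1 : ℝ) ≤ P.D₀ ∧ (P.D₀ : ℝ) ≤ (P.X : ℝ) * P.L / 4 + 2 := by
  refine ⟨by exact_mod_cast P.end_floors.1, ?_⟩
  unfold D₀; push_cast
  have h1 := P.L₀_lt
  have h2 := P.core_div_N_le
  have hX : (0 : ℝ) ≤ P.X := Nat.cast_nonneg _
  have e : 6 * (P.X : ℝ) * Cb ^ n * P.Ω * K n / P.N = 6 * P.X * (Cb ^ n * P.Ω * K n / P.N) := by ring
  rw [e] at h1
  nlinarith [mul_le_mul_of_nonneg_left h2 hX]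

/-- the END range in `ℝ`: `2^{2n+22}·X/(n+1) ≤ 2X_fin + 1` and `1 ≤ X_fin`. [cite: Nesterenko2003, §5.2 (5.12)] -/
theorem Xfin_facts : (2 : ℝ) ^ (2 * n + 22) * P.X / (n + 1) ≤ 2 * (P.Xfin : ℝ) + 1 ∧ 1 ≤ P.Xfin := by
  have hXs := P.Xs_Sd_ge
  have hX128 := P.X_floors.2.1
  have hn1 : (0 : ℝ) < (n : ℝ) + 1 := by positivity
  -- `Xfin = 2ⁿ Xs Ŝ / (n+1)` in `ℕ`: `2ⁿ Xs Ŝ < (Xfin + 1)·(n+1)`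
  have hdiv := Nat.lt_div_mul_add (a := 2 ^ n * P.Xs P.Sd) (b := n + 1) (by omega)
  have h1 : ((2 ^ n * P.Xs P.Sd : ℕ) : ℝ) < ((2 ^ n * P.Xs P.Sd / (n + 1) * (n + 1) + (n + 1) : ℕ) : ℝ) := by
    exact_mod_cast hdiv
  have eX : ((2 ^ n * P.Xs P.Sd / (n + 1) : ℕ) : ℝ) = (P.Xfin : ℝ) := by unfold Xfin; rfl
  push_cast at h1
  rw [eX] at h1
  -- `2^{2n+22} X ≤ 2ⁿ Xs Ŝ`
  have h2 : (2 : ℝ) ^ (2 * n + 22) * P.X ≤ 2 ^ n * (P.Xs P.Sd : ℝ) := by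
    rw [show 2 * n + 22 = n + (n + 22) by ring, pow_add, mul_assoc]
    exact mul_le_mul_of_nonneg_left hXs (by positivity)
  have hXf0 : (0 : ℝ) ≤ P.Xfin := Nat.cast_nonneg _
  refine ⟨?_, ?_⟩
  · rw [div_le_iff₀ hn1]
    nlinarith
  · -- `Xfin ≥ 1`: `2ⁿ Xs Ŝ ≥ 2^{2n+22} X ≥ n + 1`
    have hn2 : (n : ℝ) + 1 ≤ (2 : ℝ) ^ (2 * n + 22) := by
      have h := Nat.lt_two_pow_self (n := n + 1)
      have h' : ((n + 1 : ℕ) : ℝ) < (2 : ℝ) ^ (n + 1) := by exact_mod_cast h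
      push_cast at h'
      exact h'.le.trans (pow_le_pow_right₀ (by norm_num) (by omega))
    have h6 : ((n + 1 : ℕ) : ℝ) ≤ ((2 ^ n * P.Xs P.Sd : ℕ) : ℝ) := by
      push_cast
      have h7 : (2 : ℝ) ^ (2 * n + 22) ≤ 2 ^ (2 * n + 22) * P.X := by
        have : (1 : ℝ) ≤ P.X := by linarith
        nlinarith [pow_pos (show (0:ℝ) < 2 by norm_num) (2 * n + 22)]
      linarith
    have h5 : n + 1 ≤ 2 ^ n * P.Xs P.Sd := by exact_mod_cast h6
    unfold Xfin
    exact (Nat.le_div_iff_mul_le (by omega)).mpr (by rw [one_mul]; exact h5)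

/-- the polynomial-vs-exponential fact of (K2): `(n+1)²(n+2)⁴ ≤ 2^{2n+27}`. [folklore] -/
theorem poly_K2 (n : ℕ) : (n + 1) ^ 2 * (n + 2) ^ 4 ≤ 2 ^ (2 * n + 27) := by
  have h1 := succ_mul_pow_four_le_two_pow n
  have h2 : n + 1 ≤ 2 ^ (n + 3) := by
    have := Nat.lt_two_pow_self (n := n + 1)
    calc n + 1 ≤ 2 ^ (n + 1) := this.le
      _ ≤ 2 ^ (n + 3) := Nat.pow_le_pow_right (by norm_num) (by omega)
  calc (n + 1) ^ 2 * (n + 2) ^ 4 = (n + 1) * ((n + 1) * (n + 2) ^ 4) := by ring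
    _ ≤ 2 ^ (n + 3) * 2 ^ (n + 24) := Nat.mul_le_mul h2 h1
    _ = 2 ^ (2 * n + 27) := by rw [← pow_add]; ring_nf

/-- **(K2)** `(n+1)²·D₀ < (S₀ + 1)·(2X_fin + 1)`. [cite: Nesterenko2003, §5.2 Lemma 5.3 (5.15)–(5.16)] -/
theorem K2 : (n + 1) ^ 2 * P.D₀ < (P.S₀ + 1) * (2 * P.Xfin + 1) := by
  have hS : (16 : ℝ) * (n + 1) * P.L < (P.S₀ + 1) * ((n : ℝ) + 2) ^ 4 := by exact_mod_cast P.M_lt_S₀_succ_mul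
  obtain ⟨hXf, -⟩ := P.Xfin_facts
  have hD := P.D₀_bounds.2
  have hX := P.X_floors.2.1
  obtain ⟨hL1, hL0, -, -⟩ := P.L_real
  have hpoly : ((n : ℝ) + 1) ^ 2 * ((n : ℝ) + 2) ^ 4 ≤ (2 : ℝ) ^ (2 * n + 27) := by exact_mod_cast poly_K2 n
  have hn1 : (0 : ℝ) < (n : ℝ) + 1 := by positivity
  have hn2 : (0 : ℝ) < ((n : ℝ) + 2) ^ 4 := by positivity
  have hXL8 : (8 : ℝ) ≤ (P.X : ℝ) * P.L := by nlinarith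
  -- LHS ≤ (n+1)² XL/2
  have hlhs : ((n : ℝ) + 1) ^ 2 * P.D₀ ≤ ((n : ℝ) + 1) ^ 2 * ((P.X : ℝ) * P.L / 2) := by
    refine mul_le_mul_of_nonneg_left ?_ (by positivity); linarith
  -- RHS ≥ (S₀+1)·2^{2n+22}X/(n+1) > 16(n+1)L/(n+2)^4 · 2^{2n+22}X/(n+1)
  have hS' : (16 : ℝ) * (n + 1) * P.L / ((n : ℝ) + 2) ^ 4 < P.S₀ + 1 := by
    rw [div_lt_iff₀ hn2]; exact hS
  have hrhs : (16 : ℝ) * (n + 1) * P.L / ((n : ℝ) + 2) ^ 4 * (2 ^ (2 * n + 22) * P.X / (n + 1)) <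
      ((P.S₀ : ℝ) + 1) * (2 * (P.Xfin : ℝ) + 1) := by
    have h0 : (0 : ℝ) < 2 ^ (2 * n + 22) * P.X / (n + 1) := by positivity
    calc (16 : ℝ) * (n + 1) * P.L / ((n : ℝ) + 2) ^ 4 * (2 ^ (2 * n + 22) * P.X / (n + 1))
        < ((P.S₀ : ℝ) + 1) * (2 ^ (2 * n + 22) * P.X / (n + 1)) := mul_lt_mul_of_pos_right hS' h0
      _ ≤ ((P.S₀ : ℝ) + 1) * (2 * (P.Xfin : ℝ) + 1) := mul_le_mul_of_nonneg_left hXf (by positivity)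
  have e : (16 : ℝ) * (n + 1) * P.L / ((n : ℝ) + 2) ^ 4 * (2 ^ (2 * n + 22) * P.X / (n + 1)) =
      2 ^ (2 * n + 26) * ((P.X : ℝ) * P.L) / ((n : ℝ) + 2) ^ 4 := by
    field_simp; ring
  rw [e] at hrhs
  -- compare: (n+1)² XL/2 ≤ 2^{2n+26} XL/(n+2)^4  iff  (n+1)²(n+2)^4 ≤ 2^{2n+27}
  have hcmp : ((n : ℝ) + 1) ^ 2 * ((P.X : ℝ) * P.L / 2) ≤ 2 ^ (2 * n + 26) * ((P.X : ℝ) * P.L) / ((n : ℝ) + 2) ^ 4 := by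
    rw [le_div_iff₀ hn2]
    have hXL : (0 : ℝ) ≤ (P.X : ℝ) * P.L := by positivity
    have e2 : (2 : ℝ) ^ (2 * n + 27) = 2 * 2 ^ (2 * n + 26) := by rw [pow_succ]; ring
    nlinarith [mul_le_mul_of_nonneg_left hpoly hXL]
  have hfin : ((n : ℝ) + 1) ^ 2 * P.D₀ < ((P.S₀ : ℝ) + 1) * (2 * (P.Xfin : ℝ) + 1) := by linarith
  exact_mod_cast hfin

/-- **Exit A is refuted** for the letters `(D₀, S₀, X_fin)` and any degrees `Dm j ≤ L/2^{n+23} + 1` (e.g. `Dm = D`).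
[cite: Nesterenko2003, §5.2 Lemma 5.3] -/
theorem exitA : ∀ r d₀ : ℕ, r ≤ n → d₀ ≤ 1 →
    (n + 1).factorial * 2 ^ n * P.D₀ * (P.L / 2 ^ (n + 23) + 1) ^ r <
      Nat.choose (P.S₀ + (r + 1 - d₀)) (r + 1 - d₀) * (2 * P.Xfin + 1) *
        ((d₀ + (n - r)).factorial * 2 ^ (n - r) * P.D₀ ^ d₀) :=
  RecordExitsNumeric.exitA_of_bounds P.Xfin_facts.2 P.end_floors.1 P.K1 P.K2

end ArchG3Rec

end Summit.ABC.StewartYu
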